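import Mathlib
import Literature.Computability.AlgebraicComplexity.NestFreeMatchingPoly
import HarnessLib

/-!
# Route FifoMatching — crux `NNNotVP` (stmt-ValiantsHypothesis-11615), line `division_split`:
# LAYERED arc systems — nest-freeness is within-layer monotonicity, and the matching is by rank

First structural lemma (L1 of the gadget plan attached to the item as evidence
`design-g2-stubA-clique-gadget.md`) for the clique gadget that is to feed
`supportFnHard_of_cliqueProjection_seq` (companion `…SupportFnPadding`): when the positions of
`Fin N` carry a monotone LAYER index and every arc of a perfect matching `M` goes from a layer to
the next one,

* `mem_nestFreeMatchings_iff_monotone_of_layered` — `M` is nest-free iff it is increasing on the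
  openers of each layer (arcs between different layer pairs can never nest);
* `layered_closer` — the partner of a closer is an opener one layer down;
* `card_openers_lt_eq_card_closers_lt` — for a nest-free layered `M` and an opener `i`, the
  number of openers of `i`'s layer before `i` equals the number of closers of `M i`'s layer before
  `M i`: the matching between consecutive layers is the RANK matching ("the `r`-th push of a layer
  is popped by the `r`-th pop of the next layer" — the FIFO queue read layer by layer).

Honest framing: combinatorial bookkeeping for a gadget that is NOT yet constructed; stubs Z / A / B2,
the crux `NNNotVP` and `VP ≠ VNP` stay OPEN (NOT proved).  No definitions, no named facts.
-/

-- Sub = Summit single-conjunct layout: the duplicated namespace component is mandated by the tree.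
set_option linter.dupNamespace false

namespace Summit.ValiantsHypothesis.ValiantsHypothesis.Theorems.FifoMatching.NNNotVP.DivisionSplit

open Finset Literature.Computability.AlgebraicComplexity

variable {N : ℕ}

/-- **Layered matchings: nest-free iff increasing on the openers of each layer.**  Let
`lay : Fin N → ℕ` be monotone and let the perfect matching `M` send every opener `i < M i` to the
next layer (`lay (M i) = lay i + 1`).  Then `M` is nest-free iff for all openers `i < j` of the
same layer, `M i < M j`. [folklore] -/
theorem mem_nestFreeMatchings_iff_monotone_of_layered (lay : Fin N → ℕ) (hlay : Monotone lay)
    {M : Fin N → Fin N} (hM : M ∈ perfectMatchings N)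
    (harcs : ∀ i, i < M i → lay (M i) = lay i + 1) :
    M ∈ nestFreeMatchings N ↔
      ∀ i j, i < j → i < M i → j < M j → lay i = lay j → M i < M j := by
  obtain ⟨hinv, hfp⟩ := mem_perfectMatchings.1 hM
  constructor
  · intro hnf i j hij hi hj _
    obtain ⟨-, hnest⟩ := mem_nestFreeMatchings.1 hnf
    rcases lt_trichotomy (M i) (M j) with h | h | h
    · exact h
    · exact absurd (by rw [← hinv i, h, hinv j] : i = j) (ne_of_lt hij)
    · exact (hnest i j hij hj h).elim
  · intro hmono
    refine mem_nestFreeMatchings.2 ⟨hM, fun i j hij hj hji => ?_⟩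
    have hi : i < M i := lt_trans hij (lt_trans hj hji)
    have h1 : lay i ≤ lay j := hlay hij.le
    have h2 : lay (M j) ≤ lay (M i) := hlay hji.le
    rw [harcs i hi, harcs j hj] at h2
    have heq : lay i = lay j := le_antisymm h1 (by omega)
    exact absurd (hmono i j hij hi hj heq) (not_lt.2 hji.le)

/-- In a layered perfect matching, the partner of a closer `M j < j` is an opener one layer down:
`lay j = lay (M j) + 1`. [folklore] -/
theorem layered_closer (lay : Fin N → ℕ) {M : Fin N → Fin N} (hM : M ∈ perfectMatchings N)
    (harcs : ∀ i, i < M i → lay (M i) = lay i + 1) {j : Fin N} (hj : M j < j) :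
    lay j = lay (M j) + 1 := by
  obtain ⟨hinv, -⟩ := mem_perfectMatchings.1 hM
  have h := harcs (M j) (by rw [hinv]; exact hj)
  rwa [hinv] at h

/-- **The matching between consecutive layers is the rank matching.**  For a nest-free layered
perfect matching `M` and an opener `i` (`i < M i`), the openers of `i`'s layer before `i` are in
bijection (by `M`) with the closers of `M i`'s layer before `M i`; in particular the two counts
agree. [folklore] -/
theorem card_openers_lt_eq_card_closers_lt (lay : Fin N → ℕ) (hlay : Monotone lay)
    {M : Fin N → Fin N} (hnf : M ∈ nestFreeMatchings N)
    (harcs : ∀ i, i < M i → lay (M i) = lay i + 1) {i : Fin N} (hi : i < M i) :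
    (univ.filter fun i' : Fin N => i' < M i' ∧ lay i' = lay i ∧ i' < i).card =
      (univ.filter fun j' : Fin N => M j' < j' ∧ lay j' = lay (M i) ∧ j' < M i).card := by
  have hM := nestFreeMatchings_subset_perfectMatchings hnf
  obtain ⟨hinv, hfp⟩ := mem_perfectMatchings.1 hM
  have hmono := (mem_nestFreeMatchings_iff_monotone_of_layered lay hlay hM harcs).1 hnf
  -- `M` maps the first set bijectively onto the second
  refine card_bij (fun i' _ => M i') ?_ ?_ ?_
  · intro i' hi'
    simp only [mem_filter, mem_univ, true_and] at hi' ⊢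
    obtain ⟨h1, h2, h3⟩ := hi'
    refine ⟨by rw [hinv]; exact h1, by rw [harcs i' h1, harcs i hi, h2], ?_⟩
    exact hmono i' i h3 h1 hi h2
  · intro a ha b hb hab
    have := congrArg M hab
    rwa [hinv, hinv] at this
  · intro j' hj'
    simp only [mem_filter, mem_univ, true_and] at hj'
    obtain ⟨h1, h2, h3⟩ := hj'
    refine ⟨M j', ?_, hinv j'⟩
    simp only [mem_filter, mem_univ, true_and]
    have hop : M j' < M (M j') := by rw [hinv]; exact h1
    have hlay' : lay (M j') = lay i := by
      have e1 := layered_closer lay hM harcs h1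
      have e2 := harcs i hi
      omega
    refine ⟨hop, hlay', ?_⟩
    -- `M j' < i`: otherwise monotonicity would give `M i ≤ j'`... precisely `M i < M (M j') = j'`
    rcases lt_trichotomy (M j') i with h | h | h
    · exact h
    · exact absurd (by rw [← h, hinv] : M i = j') (ne_of_gt h3)
    · have := hmono i (M j') h hi hop hlay'.symm
      rw [hinv] at this
      exact absurd this (not_lt.2 h3.le)

end Summit.ValiantsHypothesis.ValiantsHypothesis.Theorems.FifoMatching.NNNotVP.DivisionSplit
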